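import Literature.MathematicalPhysics.QuantumFieldTheory.Balaban1983to89.B1TorusChainChart
import Literature.MathematicalPhysics.QuantumFieldTheory.Balaban1983to89.B4Lemma22HolderCubeField

/-!
# `Balaban1983to89.B1TorusCubeHolderInput` — [Balaban1983RegularityDecay] LEMMA 2.2 (2.16), THE HÖLDER MEMBER OF THE NORM (2.14)
# «|x′ − x|^{−α}|U(Ã(Γ_{x,x′}))(D^η_{Ã,μ}G_k(□,Ã)f)(x′) − (D^η_{Ã,μ}G_k(□,Ã)f)(x)| ≤ c₁‖f‖_∞», READ ON THE CUBES `□_j` OF THE (Higgs)₂,₃ TORUS AT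
# THE CUBE CONFIGURATION `Ã_j` — the per-cube HÖLDER input of the torus walk for the Hölder clause (2.24)/(1.9):
# `‖U(Ã_j(Γ))(D^ε_{Ã_j}G_j(h_jψ))(x′) − (D^ε_{Ã_j}G_j(h_jψ))(x)‖ ≤ C_H(|x − x′|/L^K)^α(L^Kε)‖ψ‖_∞` for every contour `Γ ⊂ □_j` from `x` to
# `x′` of length `≤ d|x − x′|`, from the lineage's `B4Lemma22HolderBox.lemma22_16_holder_field_explicit` (with the [B1] contours, the constant
# part of `Ã_j` removed by the gauge transformation of p. 581 as in `B4Lemma22HolderCubeField`) through the chain dictionary `B1TorusChainChart`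

statement-level skeleton of published theorems with citation tags; proofs where landed; nothing here is a claim about the Yang–Mills mass gap

CITATION HEADER (lean-in-tree rule).  T. Bałaban, *Regularity and decay of lattice Green's functions*, Commun. Math. Phys. **89** (1983)
571–597 [Balaban1983RegularityDecay] (cell paper B4; held text `paper:balaban1983-cmp89-regularity-decay`, journal page = PDF page + 570;
pp. 573, 575, 577–578, 581 read by this seat) and T. Bałaban, *(Higgs)₂,₃ quantum fields in a finite volume. I*, Commun. Math. Phys. **85**
(1982) 603–626 [Balaban1982Higgs1] ((1.7) p. 605, Prop. 2.1 (2.23)–(2.24) p. 610).  Cell `lit-balaban` (HOME `run/shared/lean/pub/lit-balaban/`),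
Phase-2 proof seat **p35** gen 10 (unit `lit-balaban-p35`); SKELETON rows **B4.Lem2.2** ((2.16) Hölder member read on the torus cubes),
**B4.Thm@573** ((1.9) per-cube input on the torus), **B1.Prop2.1** ((2.24) at `A ≠ 0`).  USED BY NAME, never restated: the lineage's
`B4Lemma22HolderBox.lemma22_16_holder_field_explicit`, `B4Lemma22HolderCubeField.{holder_threshold, abs_cubeComp_sub_le, cubeFluct_fwd_eq,
holder_gauge, constBond_add_eq_bondGauge}` (p35 gen 6), `B4CubeFieldHyps22.{cubeField_hyps, aSeq_window, smul_cubeField, fieldLink_smul,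
greenA_smul}`, `B4Lemma22Invertible.opA_isUnit_det`, `B4GaugeCovariance.{transport_gauge, fieldLink_bondGauge, b4Green_bondGauge}`,
`B4Lemma22ReduceZero.{covDeriv_gauge, supN_gauge_transpose}`; gen 8's `B1TorusCubeBoxOp` (chart, `boxField`, `acT`, `flowC`,
`pull_propagatorK`, `pull_hsmul_hTor`), `B1TorusCubeContours.gammaT` (the [B1] contours `Γ^{(K)}`), gen 9's `B1TorusCubeDeriv.smul_ofLp_covDeriv_toT`;
this seat's `B1TorusChainTransport`/`B1TorusChainChart` (`hol`, `IsTChain`, `exists_lift`, `isNNChain_lift`, `ofLp_hol`, `tdist_le_supNorm_fromT`).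

WHAT IS PRINTED.  p. 577–578: *«We will need Hölder norms: ‖f‖_{1,α} = max{sup_x|f(x)|, sup_{x,μ}|(D^η_{A,μ}f)(x)|, sup_{x,x′,μ}
|x′ − x|^{−α}|U(A(Γ_{x,x′}))(D^η_{A,μ}f)(x′) − (D^η_{A,μ}f)(x)|} (2.14) … Lemma 2.2. Let a rectangular parallelepiped □ be a sum of few large
blocks (e.g., as in the case of the cubes □_j), and let Ã be a regular vector field configuration …, constant in a neighbourhood of the boundary
of □. Then for e sufficiently small and α < 1, there exists a constant c₁ depending on d, α only, such that ‖G_k(□,Ã)f‖_{1,α} ≤ c₁‖f‖_∞ (2.16)»*;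
p. 581: *«Lemma 2.2 in the case of a constant configuration A₀ is equivalent to the case of configuration A₀ = 0 by the same argument with the
gauge transformation as before»*; p. 578: *«If any of the points x, x′ belongs to supp h_j, then both belong to □_j … We estimate the first sum
using Lemma 2.2 by Σ′ ‖h_{ω₀}G_k(□_{ω₀},A_{ω₀})h_{ω₀}‖_{(1,α),∞} … (2.20)»*.

WHAT THIS FILE PROVES (kernel-checked, zero `sorry`, one theorem + two private helpers; axioms standard).
**`cube_input_holder`** — for `0 ≤ α < 1`: a constant `C_H > 0` (Lemma 2.2 at charge 1, times `d`) and, given `(creg, β, K₀)`, a threshold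
`e₁ > 0` such that for every admissible instance (quantifier order of gen 8's `B1TorusCubeBoxOp.cube_inputs`: `K ≤ K_P`, `K ≥ 1`, `K₀ ∣ M`, `K₀ ≥
8`, `3M ≤ |T_ε|_μ`, `a` in a window, `0 < m²`, `m²(L^Kε)² ≤ m₊²`, `acT` (1.7)-regular at the effective charge `0 < e_c ≤ e₁`), every `ψ`,
direction `μ`, sites `x ≠ x′` with `x, x + εe_μ, x′, x′ + εe_μ ∈ □_j`, and EVERY nearest-neighbour chain `Γ ⊂ □_j` from `x` to `x′` with
`|Γ| ≤ d·|x − x′|` ((1.3)-distance; covers the shortest contours):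
`‖U(Ã_j(Γ))(D^ε_{Ã_j}G_j(h_jψ))(⟨x′,μ⟩) − (D^ε_{Ã_j}G_j(h_jψ))(⟨x,μ⟩)‖ ≤ C_H·(|x − x′|/L^K)^α·(L^Kε)·‖ψ‖_∞`, `G_j = G^ε_K(□_j, Ã_j)`.
Mechanism: lift `Γ` to a box chain (`B1TorusChainChart`); the lineage's (2.16) at charge `1`, constant part `0`, fluctuation `(e_c/n)θ_jA′`
with the [B1] contour system `gammaT` (hypotheses from `cubeField_hyps`, the transverse bound from `abs_cubeComp_sub_le`, invertibility
`opA_isUnit_det`, smallness `holder_threshold`); the constant part restored by the gauge `λ = −⟨A₀,·⟩` (`holder_gauge`); then the bond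
dictionary `(L^Kε)D^ε_{Ã_j} ↔ derivA`, `G_j ↔ (L^Kε)²greenA`, `U(Ã_j(Γ)) ↔ transport`, and `|z′ − z|_∞ ≤ |Γ| ≤ d|x − x′|`.
HONEST SCOPE: (2.16)'s Hölder member only (the sup members are gen 8/9's `cube_inputs`/`cube_input_deriv`), on the torus cubes, at `Ã_j`,
`0 ≤ α < 1` (the ruled range); constants depend on `(d, N, q, L, a₋, a₊, m²₊, α)`, `e₁` also on `(creg, β, K₀)`.  Unit `lit-balaban-p35`
gen 10 (literature-prover-lit-balaban-p35-g10-0).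
-/

open scoped BigOperators Matrix

noncomputable section

namespace Literature.MathematicalPhysics.QuantumFieldTheory.Balaban1983to89.B1TorusCubeHolderInput

open Matrix (toEuclideanCLM)
open Literature.MathematicalPhysics.QuantumFieldTheory.Balaban1983to89.HiggsLattice
open Literature.MathematicalPhysics.QuantumFieldTheory.Balaban1983to89.HiggsAveraging
open Literature.MathematicalPhysics.QuantumFieldTheory.Balaban1983to89.HiggsCovariance
open Literature.MathematicalPhysics.QuantumFieldTheory.Balaban1983to89.HiggsCovariancePos
  (shift_unshift unshift_shift isUnit_covOpK covOpK_mul_propagatorK covOpK_propagatorK_apply)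
open Literature.MathematicalPhysics.QuantumFieldTheory.Balaban1983to89.B1TorusCubeCover
open Literature.MathematicalPhysics.QuantumFieldTheory.Balaban1983to89.B1TorusCubeLocality26
open Literature.MathematicalPhysics.QuantumFieldTheory.Balaban1983to89.B1TorusCubeChart
open Literature.MathematicalPhysics.QuantumFieldTheory.Balaban1983to89.B1TorusCubeContours
open Literature.MathematicalPhysics.QuantumFieldTheory.Balaban1983to89.B4GaugeCovariance
open Literature.MathematicalPhysics.QuantumFieldTheory.Balaban1983to89.B4Commutators25to211 (mulH fld_mulH_mulVec)
open Literature.MathematicalPhysics.QuantumFieldTheory.Balaban1983to89.B4Reflection242 (boxDom mem_boxDom blk nbrs mem_nbrs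
  nbrs_comm blk_mem_boxDom)
open Literature.MathematicalPhysics.QuantumFieldTheory.Balaban1983to89.B4Lower18Regular (e1 e1_apply_self e1_apply_ne
  lsum PathRel baseEmb abs_lsum_le blkWt_ne_zero)
open Literature.MathematicalPhysics.QuantumFieldTheory.Balaban1983to89.B4Lower18RegularRegion (compField compField_add e1_inj)
open Literature.MathematicalPhysics.QuantumFieldTheory.Balaban1983to89.B4Lemma21Region (siteNorm)
open Literature.MathematicalPhysics.QuantumFieldTheory.Balaban1983to89.B4ContourShift (supNorm supNorm_nonneg)
open Literature.MathematicalPhysics.QuantumFieldTheory.Balaban1983to89.B4Lemma22Reduce231 (supN le_supN supN_le supN_nonneg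
  siteNorm_nonneg siteNorm_smul)
open Literature.MathematicalPhysics.QuantumFieldTheory.Balaban1983to89.B4Lemma22PertVSup (supN_smul_le)
open Literature.MathematicalPhysics.QuantumFieldTheory.Balaban1983to89.B4Lemma22ReduceZero (Box opA greenA derivA covDeriv_gauge
  supN_gauge_transpose)
open Literature.MathematicalPhysics.QuantumFieldTheory.Balaban1983to89.B4Lemma22Invertible (opA_isUnit_det)
open Literature.MathematicalPhysics.QuantumFieldTheory.Balaban1983to89.B4PartitionUnity22 (hprof thetaProf D1 D2 D1_nonneg D2_nonneg
  contDiff_hprof hasCompactSupport_hprof contDiff_thetaProf hasCompactSupport_thetaProf)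
open Literature.MathematicalPhysics.QuantumFieldTheory.Balaban1983to89.B4Eq220PartitionSizes (hZ hBox hsize_hBox)
open Literature.MathematicalPhysics.QuantumFieldTheory.Balaban1983to89.B4CubeFields22 (thetaZ cubeField cubeFluct cubeComp
  cubeField_step cubeField_antisymm)
open Literature.MathematicalPhysics.QuantumFieldTheory.Balaban1983to89.B4CubeFieldHyps22 (cubeField_hyps aSeq_window smul_cubeField
  fieldLink_smul greenA_smul derivA_smul)
open Literature.MathematicalPhysics.QuantumFieldTheory.Balaban1983to89.B4Eq220CommutatorField (supN_mulH_le)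
open Literature.MathematicalPhysics.QuantumFieldTheory.Balaban1983to89.B4Lemma22HolderBox (pathSum IsNNChain
  lemma22_16_holder_field_explicit)
open Literature.MathematicalPhysics.QuantumFieldTheory.Balaban1983to89.B4Lemma22HolderCubeField (holder_threshold abs_cubeComp_sub_le
  cubeFluct_fwd_eq holder_gauge constBond_add_eq_bondGauge)
open Literature.MathematicalPhysics.QuantumFieldTheory.Balaban1983to89.B1TorusCubeBoxOp
open Literature.MathematicalPhysics.QuantumFieldTheory.Balaban1983to89.B1TorusCubeDeriv (smul_ofLp_covDeriv_toT)
open Literature.MathematicalPhysics.QuantumFieldTheory.Balaban1983to89.B1TorusChainTransport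
open Literature.MathematicalPhysics.QuantumFieldTheory.Balaban1983to89.B1TorusChainChart

variable {P : HiggsLattice.Params} {N : ℕ}

/-- The Euclidean site norm of the coordinate vector of `v ∈ ℝ^N` is `‖v‖`. [folklore] -/
private theorem siteNorm_ofLp (v : EuclideanSpace ℝ (Fin N)) : siteNorm (WithLp.ofLp v) = ‖v‖ := by
  rw [siteNorm, EuclideanSpace.norm_eq]
  congr 1
  simp only [dotProduct, Real.norm_eq_abs, sq, abs_mul_abs_self]

/-- distinct integer vectors are at sup-distance at least `1`. [folklore] -/
private theorem one_le_supNorm_of_ne' {d : ℕ} {z z' : Fin (d + 1) → ℤ} (h : z' ≠ z) : 1 ≤ supNorm (z' - z) := by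
  obtain ⟨i, hi⟩ : ∃ i, z' i ≠ z i := by
    by_contra hc
    push Not at hc
    exact h (funext hc)
  have h1 : (1 : ℤ) ≤ |(z' - z) i| := by
    rw [Pi.sub_apply]
    exact Int.one_le_abs (sub_ne_zero.mpr hi)
  have h1' : (1 : ℝ) ≤ ((|(z' - z) i| : ℤ) : ℝ) := by exact_mod_cast h1
  exact h1'.trans (B4ContourShift.abs_le_supNorm _ _)

/-- the zero constant configuration is the zero bond function. [folklore] -/
private theorem constBond_zero' {d : ℕ} {X : Type*} (pos : X → Fin (d + 1) → ℤ) :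
    constBond (0 : Fin (d + 1) → ℝ) pos = 0 := by
  funext u v
  simp [constBond]

section Inputs

variable {K K₀ : ℕ}

set_option maxHeartbeats 1600000 in
/-- **LEMMA 2.2 (2.16), HÖLDER MEMBER, ON THE CUBES OF THE (Higgs)₂,₃ TORUS AT `Ã_j` — THE PER-CUBE HÖLDER INPUT OF THE TORUS WALK FOR
(2.24)/(1.9).**  For `0 ≤ α < 1` there is `C_H > 0` and, for every regularity pair `(creg, β)` and cube size `K₀ ≥ 8`, a threshold `e₁ > 0` such
that on every admissible instance with `acT` (1.7)-regular at the effective charge `0 < e_c ≤ e₁`: for every `ψ`, `μ`, sites `x ≠ x′` with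
`x, x + εe_μ, x′, x′ + εe_μ ∈ □_j`, and every nearest-neighbour chain `Γ ⊂ □_j` from `x` to `x′` with `|Γ| ≤ d|x − x′|`,
`‖U(Ã_j(Γ))(D^ε_{Ã_j}G_j(h_jψ))(⟨x′,μ⟩) − (D^ε_{Ã_j}G_j(h_jψ))(⟨x,μ⟩)‖ ≤ C_H(|x − x′|/L^K)^α(L^Kε)‖ψ‖_∞` («‖G_k(□,Ã)f‖_{1,α} ≤ c₁‖f‖_∞»
in the model's units, third member of (2.14)).
[cite: Balaban1983RegularityDecay, Lemma 2.2 (2.16) p.578 with (2.14) p.577, p.581 (gauge), §2 p.575 (Ã_j), (2.20) p.578]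
[cite: Balaban1982Higgs1, Prop. 2.1 (2.23)–(2.24) p.610] -/
theorem cube_input_holder (C : ChargeData N) (d0 ℓ0 : ℕ) (hℓ0 : 1 ≤ ℓ0) (amin aplus m2plus : ℝ) (ha : 0 < amin)
    {α : ℝ} (hα0 : 0 ≤ α) (hα1 : α < 1) :
    ∃ CH : ℝ, 0 < CH ∧ ∀ (creg β : ℝ), 0 ≤ creg → 0 < β → ∀ (K₀ : ℕ), 8 ≤ K₀ →
      ∃ e₁ : ℝ, 0 < e₁ ∧ ∀ (P : HiggsLattice.Params), dd P = d0 → P.L - 1 = ℓ0 →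
        ∀ (K : ℕ), 1 ≤ K → K ≤ P.K → K₀ ∣ P.M → (∀ μ, 3 * half P K K₀ ≤ P.sitesPerDir 0 μ) →
        ∀ (a msq : ℝ), amin ≤ a → a ≤ aplus → 0 < msq → msq * P.mesh K ^ 2 ≤ m2plus →
        ∀ (j : Lab P K K₀) (A : HiggsLattice.VecField P 0) (ec : ℝ), 0 < ec → ec ≤ e₁ →
          (∀ y ∈ Box (dd P) (P.L - 1) K (M2 P K₀), ∀ i i' : Fin (dd P + 1),
            |acT K K₀ j ((((P.L - 1 + 1) ^ K : ℕ) : ℝ) * P.mesh 0 * C.e / ec) A (y + e1 i) i'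
              - acT K K₀ j ((((P.L - 1 + 1) ^ K : ℕ) : ℝ) * P.mesh 0 * C.e / ec) A y i'|
              ≤ creg * ec ^ (β - 1) / ((P.L - 1 + 1) ^ K : ℕ)) →
          ∀ (ψ : HiggsLattice.ScalarField P 0 N) (μ : Fin P.d) (x x' : HiggsLattice.Site P 0) (l : List (HiggsLattice.Site P 0)),
            x ∈ cube K K₀ j → x.shift μ ∈ cube K K₀ j → x' ∈ cube K K₀ j → x'.shift μ ∈ cube K K₀ j → x' ≠ x →
            IsTChain x l → pathEnd x l = x' → (∀ y ∈ l, y ∈ cube K K₀ j) →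
            (l.length : ℝ) ≤ (P.d : ℝ) * HiggsLattice.Site.tdist x x' →
            ‖hol C (cubeVec K K₀ j A) x l
                  (covDeriv C (cubeVec K K₀ j A) (propagatorK C (cube K K₀ j) (cubeVec K K₀ j A) msq a K (hTor K K₀ j • ψ)) ⟨x', μ⟩)
                - covDeriv C (cubeVec K K₀ j A) (propagatorK C (cube K K₀ j) (cubeVec K K₀ j A) msq a K (hTor K K₀ j • ψ)) ⟨x, μ⟩‖
              ≤ CH * ((HiggsLattice.Site.tdist x x' : ℝ) / (P.L : ℝ) ^ K) ^ α * P.mesh K * ‖ψ‖ := by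
  classical
  -- the constants of Lemma 2.2 (2.16) at charge 1, generic contour systems
  obtain ⟨c, c₁, hc, hc₁, hL⟩ := lemma22_16_holder_field_explicit (flowC C) (ellC_nonneg C) (flowC_lipschitz C) 1 d0 ℓ0 hℓ0
    amin aplus m2plus ha α hα0 hα1
  by_cases hapl : aplus < amin
  · refine ⟨1, one_pos, fun creg β _ _ K₀ _ => ⟨1, one_pos, ?_⟩⟩
    intro P _ _ K _ _ _ _ a msq e1' e2
    exact absurd (e1'.trans e2) (not_le.2 hapl)
  rw [not_lt] at hapl
  have hℓ₁ : 0 ≤ ellC C := ellC_nonneg C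
  set CH : ℝ := 2 * c₁ * ((d0 : ℝ) + 1) with hCH_def
  have hCH0 : 0 < CH := by positivity
  refine ⟨CH, hCH0, fun creg β hcreg hβ K₀ hK₀8 => ?_⟩
  obtain ⟨e₁, he₁, hth⟩ := holder_threshold d0 (c := c) (aplus := aplus) hℓ₁ hc.le ha hcreg hβ (2 * K₀) K₀
  refine ⟨e₁, he₁, ?_⟩
  intro P hd hl K hK1 hK hK₀ hN3 a msq e1' e2 hmsq e4 j A ec hec hle h17
  subst hd; subst hl
  -- the instance
  have hK₀' : 1 ≤ K₀ := le_trans (by norm_num) hK₀8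
  have hℓ : 1 ≤ P.L - 1 := hℓ0
  have hL2 : 2 ≤ P.L := by omega
  have hn : 1 ≤ (P.L - 1 + 1) ^ K := one_le_n P K
  have hn2 : 2 ≤ (P.L - 1 + 1) ^ K := by
    calc 2 ≤ P.L - 1 + 1 := by omega
      _ = (P.L - 1 + 1) ^ 1 := (pow_one _).symm
      _ ≤ (P.L - 1 + 1) ^ K := Nat.pow_le_pow_right (by omega) hK1
  have hnK : 16 ≤ (P.L - 1 + 1) ^ K * K₀ := by nlinarith
  have hnr : (0 : ℝ) < (((P.L - 1 + 1) ^ K : ℕ) : ℝ) := by exact_mod_cast hn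
  have hnR : ((((P.L - 1 + 1) ^ K : ℕ)) : ℝ) = (P.L : ℝ) ^ K := by rw [predL_succ, Nat.cast_pow]
  have hM : ∀ i, 1 ≤ M2 P K₀ i := fun i => by unfold M2; omega
  have hS : ∀ i, M2 P K₀ i ≤ 2 * K₀ := fun i => le_rfl
  have hjlo : ∀ μ : Fin (dd P + 1), (1 : ℤ) ≤ (fun _ : Fin (dd P + 1) => (1 : ℤ)) μ := fun μ => le_rfl
  have hjhi : ∀ μ : Fin (dd P + 1), (K₀ : ℤ) * ((fun _ : Fin (dd P + 1) => (1 : ℤ)) μ + 1) ≤ M2 P K₀ μ := by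
    intro μ; unfold M2; push_cast; linarith
  have ha' : 0 < a := lt_of_lt_of_le ha e1'
  have hm2 : 0 ≤ msq * P.mesh K ^ 2 := by positivity
  have hmeshK : 0 < P.mesh K := P.mesh_pos K
  have hh2 : 2 ≤ half P K K₀ := two_le_half hK₀8
  have hS3 : ∀ μ', 2 < P.sitesPerDir 0 μ' := fun μ' => by
    have := hN3 μ'; have : 1 ≤ half P K K₀ := le_trans (by norm_num) hh2; omega
  obtain ⟨hak1, hak2⟩ := aSeq_window hℓ hK1 ha e1' e2
  -- the scaled field and the coupling `κ = e_c/n`, `κσ = εe`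
  set σ : ℝ := (((P.L - 1 + 1) ^ K : ℕ) : ℝ) * P.mesh 0 * C.e / ec with hσ
  have hκσ : ec / (((P.L - 1 + 1) ^ K : ℕ) : ℝ) * σ = P.mesh 0 * C.e := by
    rw [hσ]; field_simp
  obtain ⟨hθ1, hθT1, -, hsm⟩ := hth ec hec hle _ hak1 hak2
  obtain ⟨-, hA', hder, hbd⟩ := cubeField_hyps (d := dd P) hn hS hK₀' hnK hjlo hjhi hcreg hec h17 (β := β)
  -- contour-system facts for the lineage
  have hend' : ∀ y x, blkWt ((P.L - 1 + 1) ^ K) (M2 P K₀) (fun i => (P.L - 1 + 1) ^ K * M2 P K₀ i) y x ≠ 0 →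
      pathEnd (baseEmb (one_le_n P K) (M2 P K₀) y) (gammaT P K K₀ y x) = x := fun y x h => gammaT_hend y x h
  have hnn' : ∀ y x, blkWt ((P.L - 1 + 1) ^ K) (M2 P K₀) (fun i => (P.L - 1 + 1) ^ K * M2 P K₀ i) y x ≠ 0 →
      PathRel (fun u v : ↥(Box (dd P) (P.L - 1) K (M2 P K₀)) => v.1 ∈ nbrs u.1)
        (baseEmb (one_le_n P K) (M2 P K₀) y) (gammaT P K K₀ y x) := fun y x _ => gammaT_nn y x
  -- the quantities θ, θ' of the lineage
  set θ : ℝ := ((dd P : ℝ) + 1) * ((2 * K₀ : ℕ) : ℝ) * creg * ec ^ β with hθ_def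
  set θ' : ℝ := creg * ec ^ β * (1 + D1 thetaProf * (((dd P : ℝ) + 1) * ((2 * K₀ : ℕ) : ℝ)) / K₀) with hθ'_def
  have hθ0 : 0 ≤ θ := by have := (Real.rpow_pos_of_pos hec β).le; positivity
  have hD : 0 ≤ D1 thetaProf := D1_nonneg contDiff_thetaProf hasCompactSupport_thetaProf
  have hθ'0 : 0 ≤ θ' := by
    have := (Real.rpow_pos_of_pos hec β).le
    positivity
  have hθT0 : 0 ≤ 2 * ((dd P : ℝ) + 1) * θ' := by positivity
  set A₀' : Fin (dd P + 1) → ℝ := fun μ => ec / (((P.L - 1 + 1) ^ K : ℕ) : ℝ) * acT K K₀ j σ A 0 μ with hA₀'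
  set A' : ↥(Box (dd P) (P.L - 1) K (M2 P K₀)) → ↥(Box (dd P) (P.L - 1) K (M2 P K₀)) → ℝ := fun u v =>
    ec / (((P.L - 1 + 1) ^ K : ℕ) : ℝ) * cubeFluct (Box (dd P) (P.L - 1) K (M2 P K₀)) ((P.L - 1 + 1) ^ K) K₀ (fun _ => 1)
      (acT K K₀ j σ A 0) (acT K K₀ j σ A) u v with hA'_def
  have hfield : (fun u v => ec / (((P.L - 1 + 1) ^ K : ℕ) : ℝ) * boxField K K₀ j σ A u v)
      = constBond A₀' Subtype.val + A' :=
    smul_cubeField _ _ _ _ _ _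
  -- invertibility at the fluctuation field (constant part zero)
  have hunit : IsUnit (opA (dd P) (flowC C) 1 (P.L - 1) K a (msq * P.mesh K ^ 2) (M2 P K₀)
      (baseEmb (one_le_n P K) (M2 P K₀)) (gammaT P K K₀) (constBond (0 : Fin (dd P + 1) → ℝ) Subtype.val + A')).det :=
    opA_isUnit_det (flowC C) 1 hℓ hK1 ha' hm2 (M2 P K₀) hnn' hend' _
  -- the vacuous size of the zero constant part
  have hA0 : ∀ ν, |1 * (0 : Fin (dd P + 1) → ℝ) ν| ≤ θ / ((P.L - 1 + 1) ^ K : ℕ) := fun ν => by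
    rw [Pi.zero_apply, mul_zero, abs_zero]; positivity
  -- the transverse Lipschitz bound of `Ã_j`
  have hNi : ∀ i, 1 ≤ (P.L - 1 + 1) ^ K * M2 P K₀ i := fun i => le_trans hn (Nat.le_mul_of_pos_right _ (hM i))
  have hT : ∀ i, (((P.L - 1 + 1) ^ K * M2 P K₀ i : ℕ) : ℤ) ≤ (((P.L - 1 + 1) ^ K : ℕ) : ℤ) * ((2 * K₀ : ℕ) : ℤ) := fun i => by
    push_cast; unfold M2; push_cast; nlinarith
  have hδ : 0 ≤ creg * ec ^ (β - 1) / ((P.L - 1 + 1) ^ K : ℕ) := by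
    have := (Real.rpow_pos_of_pos hec (β - 1)).le; positivity
  have hA'' : ∀ (ν : Fin (dd P + 1)) (u ue u' ue' : ↥(Box (dd P) (P.L - 1) K (M2 P K₀))), ue.1 = u.1 + e1 ν → ue'.1 = u'.1 + e1 ν →
      |1 * (A' u' ue' - A' u ue)|
        ≤ 2 * ((dd P : ℝ) + 1) * θ' * supNorm (u'.1 - u.1) / ((((P.L - 1 + 1) ^ K : ℕ) : ℝ)) ^ 2 := by
    intro ν u ue u' ue' hue hue'
    have hb := abs_cubeComp_sub_le hNi hT hδ h17 hn hK₀' (fun _ : Fin (dd P + 1) => (1 : ℤ)) u.2 u'.2 ν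
    rw [one_mul, hA'_def]
    dsimp only
    rw [cubeFluct_fwd_eq ((P.L - 1 + 1) ^ K) K₀ (fun _ => (1 : ℤ)) (acT K K₀ j σ A 0) (acT K K₀ j σ A) hue,
      cubeFluct_fwd_eq ((P.L - 1 + 1) ^ K) K₀ (fun _ => (1 : ℤ)) (acT K K₀ j σ A 0) (acT K K₀ j σ A) hue', ← mul_sub,
      show cubeComp ((P.L - 1 + 1) ^ K) K₀ (fun _ => (1 : ℤ)) (acT K K₀ j σ A 0) (acT K K₀ j σ A) u'.1 ν - acT K K₀ j σ A 0 ν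
          - (cubeComp ((P.L - 1 + 1) ^ K) K₀ (fun _ => (1 : ℤ)) (acT K K₀ j σ A 0) (acT K K₀ j σ A) u.1 ν - acT K K₀ j σ A 0 ν)
        = cubeComp ((P.L - 1 + 1) ^ K) K₀ (fun _ => (1 : ℤ)) (acT K K₀ j σ A 0) (acT K K₀ j σ A) u'.1 ν
          - cubeComp ((P.L - 1 + 1) ^ K) K₀ (fun _ => (1 : ℤ)) (acT K K₀ j σ A 0) (acT K K₀ j σ A) u.1 ν by ring,
      abs_mul, abs_of_pos (by positivity : (0 : ℝ) < ec / ((P.L - 1 + 1) ^ K : ℕ))]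
    calc ec / ((P.L - 1 + 1) ^ K : ℕ) * |cubeComp ((P.L - 1 + 1) ^ K) K₀ (fun _ => (1 : ℤ)) (acT K K₀ j σ A 0) (acT K K₀ j σ A) u'.1 ν
          - cubeComp ((P.L - 1 + 1) ^ K) K₀ (fun _ => (1 : ℤ)) (acT K K₀ j σ A 0) (acT K K₀ j σ A) u.1 ν|
        ≤ ec / ((P.L - 1 + 1) ^ K : ℕ) * (2 * (((dd P : ℝ) + 1) * supNorm (u'.1 - u.1))
            * (creg * ec ^ (β - 1) / ((P.L - 1 + 1) ^ K : ℕ)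
              * (1 + D1 thetaProf * (((dd P : ℝ) + 1) * ((((P.L - 1 + 1) ^ K : ℕ) : ℤ) * ((2 * K₀ : ℕ) : ℤ) : ℤ))
                / (((((P.L - 1 + 1) ^ K : ℕ)) : ℝ) * K₀)))) := mul_le_mul_of_nonneg_left hb (by positivity)
      _ = 2 * ((dd P : ℝ) + 1) * (creg * (ec * ec ^ (β - 1)) * (1 + D1 thetaProf * (((dd P : ℝ) + 1) * ((2 * K₀ : ℕ) : ℝ)) / K₀))
            * supNorm (u'.1 - u.1) / ((((P.L - 1 + 1) ^ K : ℕ)) : ℝ) ^ 2 := by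
          push_cast; field_simp
      _ = 2 * ((dd P : ℝ) + 1) * θ' * supNorm (u'.1 - u.1) / ((((P.L - 1 + 1) ^ K : ℕ)) : ℝ) ^ 2 := by
          rw [hθ'_def, Real.rpow_sub_one hec.ne', mul_div_cancel₀ _ hec.ne']
  -- the contour sums along the [B1] contours
  have hτ : ∀ y x, blkWt ((P.L - 1 + 1) ^ K) (M2 P K₀) (fun i => (P.L - 1 + 1) ^ K * M2 P K₀ i) y x ≠ 0 →
      |1 * lsum A' (baseEmb (one_le_n P K) (M2 P K₀) y) (gammaT P K K₀ y x)| ≤ ((dd P : ℝ) + 1) * θ := by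
    intro y x _
    have h1 := abs_lsum_le (r := fun u v : ↥(Box (dd P) (P.L - 1) K (M2 P K₀)) => v.1 ∈ nbrs u.1) (κ := 1) (B := A')
      (ρ := θ / ((P.L - 1 + 1) ^ K : ℕ)) (fun u v huv => hA' u v huv) _ _ (gammaT_nn y x)
    have hlen := length_gammaT_le y x
    have hlenR : ((gammaT P K K₀ y x).length : ℝ) ≤ ((dd P : ℝ) + 1) * ((((P.L - 1 + 1) ^ K : ℕ) : ℝ) - 1) := by
      rw [predL_succ]
      have : (((gammaT P K K₀ y x).length : ℤ) : ℝ) ≤ ((((dd P : ℤ) + 1) * ((P.L : ℤ) ^ K - 1) : ℤ) : ℝ) := by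
        exact_mod_cast hlen
      push_cast at this ⊢
      exact this
    refine h1.trans ?_
    rw [div_eq_mul_inv]
    have hθn : 0 ≤ θ * ((((P.L - 1 + 1) ^ K : ℕ) : ℝ))⁻¹ := by positivity
    calc ((gammaT P K K₀ y x).length : ℝ) * (θ * ((((P.L - 1 + 1) ^ K : ℕ) : ℝ))⁻¹)
        ≤ ((dd P : ℝ) + 1) * ((((P.L - 1 + 1) ^ K : ℕ) : ℝ) - 1) * (θ * ((((P.L - 1 + 1) ^ K : ℕ) : ℝ))⁻¹) :=
          mul_le_mul_of_nonneg_right hlenR hθn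
      _ = ((dd P : ℝ) + 1) * θ * (((((P.L - 1 + 1) ^ K : ℕ) : ℝ) - 1) * ((((P.L - 1 + 1) ^ K : ℕ) : ℝ))⁻¹) := by ring
      _ ≤ ((dd P : ℝ) + 1) * θ * 1 := by
          refine mul_le_mul_of_nonneg_left ?_ (by positivity)
          rw [← div_eq_mul_inv, div_le_one hnr]; linarith
      _ = ((dd P : ℝ) + 1) * θ := mul_one _
  have hτ0 : 0 ≤ ((dd P : ℝ) + 1) * θ := by positivity
  -- the gauge that puts the constant part back
  set σg : ↥(Box (dd P) (P.L - 1) K (M2 P K₀)) → ℝ := linGauge A₀' Subtype.val with hσg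
  set g : ↥(Box (dd P) (P.L - 1) K (M2 P K₀)) → Matrix (Fin N) (Fin N) ℝ := fun u => (flowC C).U (1 * σg u) with hg_def
  have hg : IsGauge g := (flowC C).isGauge _
  have hfield' : (fun u v => ec / (((P.L - 1 + 1) ^ K : ℕ) : ℝ) * boxField K K₀ j σ A u v) = bondGauge σg A' := by
    rw [hfield, hσg, ← constBond_add_eq_bondGauge]
  have hW : fieldLink (flowC C) (ec / (((P.L - 1 + 1) ^ K : ℕ) : ℝ)) (boxField K K₀ j σ A) = gaugeKer g g (fieldLink (flowC C) 1 A') := by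
    rw [fieldLink_smul, hfield', fieldLink_bondGauge]
  have hDer : ∀ i, derivA (dd P) (flowC C) (ec / (((P.L - 1 + 1) ^ K : ℕ) : ℝ)) (P.L - 1) K (M2 P K₀) (boxField K K₀ j σ A) i
      = blockDiag g * derivA (dd P) (flowC C) 1 (P.L - 1) K (M2 P K₀) A' i * (blockDiag g)ᵀ := by
    intro i; unfold derivA; rw [hW, covDeriv_gauge hg]
  have hGr : greenA (dd P) (flowC C) (ec / (((P.L - 1 + 1) ^ K : ℕ) : ℝ)) (P.L - 1) K a (msq * P.mesh K ^ 2) (M2 P K₀)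
        (baseEmb (one_le_n P K) (M2 P K₀)) (gammaT P K K₀) (boxField K K₀ j σ A)
      = blockDiag g * greenA (dd P) (flowC C) 1 (P.L - 1) K a (msq * P.mesh K ^ 2) (M2 P K₀)
          (baseEmb (one_le_n P K) (M2 P K₀)) (gammaT P K K₀) A' * (blockDiag g)ᵀ := by
    rw [greenA_smul, hfield']
    unfold greenA
    rw [b4Green_bondGauge (flowC C) 1 _ (msq * P.mesh K ^ 2) _ hend' σg A']
  -- the torus data: chain, lift, box points
  intro ψ μ x x' l hxc hsc hx'c hs'c hne hch hend hlc hlen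
  set Φ := mulH (hBox ((P.L - 1 + 1) ^ K) K₀ (M2 P K₀) (fun _ => 1)) *ᵥ pull K K₀ j ψ with hΦ
  set u := propagatorK C (cube K K₀ j) (cubeVec K K₀ j A) msq a K (hTor K K₀ j • ψ) with hu_def
  have hu : pull K K₀ j u = P.mesh K ^ 2 • (greenA (dd P) (flowC C) (ec / (((P.L - 1 + 1) ^ K : ℕ) : ℝ)) (P.L - 1) K a
      (msq * P.mesh K ^ 2) (M2 P K₀) (baseEmb (one_le_n P K) (M2 P K₀)) (gammaT P K K₀) (boxField K K₀ j σ A) *ᵥ Φ) := by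
    rw [hu_def, pull_propagatorK C hK hK1 hK₀ hK₀8 hN3 hL2 j hκσ ha' hmsq A, pull_hsmul_hTor hK hK₀ hK₀' j ψ]
  -- box points of `x`, `x′`, their forward bonds
  set z : Fin (dd P + 1) → ℤ := fromT K K₀ j x with hz_def
  have hz : z ∈ Box (dd P) (P.L - 1) K (M2 P K₀) := (mem_cube_iff hK hK₀ hK₀' j x).1 hxc
  have hxz : toT K K₀ j z = x := toT_fromT j x
  set z' : Fin (dd P + 1) → ℤ := fromT K K₀ j x' with hz'_def
  have hz' : z' ∈ Box (dd P) (P.L - 1) K (M2 P K₀) := (mem_cube_iff hK hK₀ hK₀' j x').1 hx'c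
  have hxz' : toT K K₀ j z' = x' := toT_fromT j x'
  set i : Fin (dd P + 1) := (castD P).symm μ with hi_def
  have hμ : castD P i = μ := Equiv.apply_symm_apply _ _
  have hze : z + e1 i ∈ Box (dd P) (P.L - 1) K (M2 P K₀) :=
    (add_e1_mem_box_iff hK hK₀ hK₀' hN3 hh2 j hz i).2 (by rw [hxz, hμ]; exact hsc)
  have hze' : z' + e1 i ∈ Box (dd P) (P.L - 1) K (M2 P K₀) :=
    (add_e1_mem_box_iff hK hK₀ hK₀' hN3 hh2 j hz' i).2 (by rw [hxz', hμ]; exact hs'c)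
  have hneB : z' ≠ z := fun e => hne (by rw [← hxz', ← hxz, e])
  -- the lift of the chain
  obtain ⟨lB, hlB⟩ := exists_lift hK hK₀ hK₀' j l hlc
  have hchB : IsTChain x (lB.map fun w => toT K K₀ j w.1) := by rw [hlB]; exact hch
  have hNN : IsNNChain (⟨z, hz⟩ : ↥(Box (dd P) (P.L - 1) K (M2 P K₀))) lB := isNNChain_lift hK hK₀ hK₀' hN3 hh2 j lB ⟨z, hz⟩ x hxz hchB
  have hlendB : pathEnd (⟨z, hz⟩ : ↥(Box (dd P) (P.L - 1) K (M2 P K₀))) lB = ⟨z', hz'⟩ := by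
    apply Subtype.ext
    have h1 := toT_pathEnd_lift (K := K) (K₀ := K₀) j lB ⟨z, hz⟩
    simp only at h1
    rw [hxz, hlB, hend] at h1
    have h2 := congrArg (fromT K K₀ j) h1
    rw [fromT_toT_of_mem hK hK₀ hK₀' j (pathEnd (⟨z, hz⟩ : ↥(Box (dd P) (P.L - 1) K (M2 P K₀))) lB).2] at h2
    exact h2
  have hlenB' : (lB.length : ℝ) = l.length := by rw [← hlB, List.length_map]
  have htd : (HiggsLattice.Site.tdist x x' : ℝ) ≤ supNorm (z' - z) := tdist_le_supNorm_fromT j x x'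
  have hd1 : ((dd P : ℝ) + 1) = (P.d : ℝ) := by rw [← dd_succ P]; push_cast; ring
  have hlenB : (lB.length : ℝ) ≤ ((dd P : ℝ) + 1) * supNorm (z' - z) := by
    rw [hlenB', hd1]
    exact hlen.trans (mul_le_mul_of_nonneg_left htd (Nat.cast_nonneg _))
  have hsN1 : 1 ≤ supNorm (z' - z) := one_le_supNorm_of_ne' hneB
  have hsN0 : 0 < supNorm (z' - z) := lt_of_lt_of_le one_pos hsN1
  -- Lemma 2.2 (2.16) at charge 1, constant part 0, fluctuation `A'`, source `𝒢ᵀΦ`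
  have main := hL K hK1 a _ e1' e2 hm2 e4 (M2 P K₀) hM (baseEmb (one_le_n P K) (M2 P K₀)) (gammaT P K K₀) hend'
    0 A' θ (2 * ((dd P : ℝ) + 1) * θ') θ' (((dd P : ℝ) + 1) * θ)
    hunit hθ0 hθ1 hA0 hA' hθT0 hθT1 hA'' hθ'0 hder hbd hτ0 hτ hsm i ⟨z, hz⟩ ⟨z + e1 i, hze⟩ ⟨z', hz'⟩ ⟨z' + e1 i, hze'⟩
    rfl rfl hneB lB hNN hlendB hlenB ((blockDiag g)ᵀ *ᵥ Φ)
  rw [constBond_zero', zero_add, supN_gauge_transpose hg] at main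
  -- put back the constant part: the Hölder quantity at `boxField`, coupling `κ = e_c/n`
  have hTr : transport (fieldLink (flowC C) (ec / (((P.L - 1 + 1) ^ K : ℕ) : ℝ)) (boxField K K₀ j σ A))
      (⟨z, hz⟩ : ↥(Box (dd P) (P.L - 1) K (M2 P K₀))) lB
      = g ⟨z, hz⟩ * transport (fieldLink (flowC C) 1 A') ⟨z, hz⟩ lB * (g ⟨z', hz'⟩)ᵀ := by
    rw [hW, transport_gauge hg, hlendB]
  have boxH : ((((P.L - 1 + 1) ^ K : ℕ) : ℝ) / supNorm (z' - z)) ^ α *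
      siteNorm (transport (fieldLink (flowC C) (ec / (((P.L - 1 + 1) ^ K : ℕ) : ℝ)) (boxField K K₀ j σ A)) ⟨z, hz⟩ lB
          *ᵥ fld (derivA (dd P) (flowC C) (ec / (((P.L - 1 + 1) ^ K : ℕ) : ℝ)) (P.L - 1) K (M2 P K₀) (boxField K K₀ j σ A) i
              *ᵥ (greenA (dd P) (flowC C) (ec / (((P.L - 1 + 1) ^ K : ℕ) : ℝ)) (P.L - 1) K a (msq * P.mesh K ^ 2) (M2 P K₀)
                  (baseEmb (one_le_n P K) (M2 P K₀)) (gammaT P K K₀) (boxField K K₀ j σ A) *ᵥ Φ)) ⟨z', hz'⟩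
        - fld (derivA (dd P) (flowC C) (ec / (((P.L - 1 + 1) ^ K : ℕ) : ℝ)) (P.L - 1) K (M2 P K₀) (boxField K K₀ j σ A) i
              *ᵥ (greenA (dd P) (flowC C) (ec / (((P.L - 1 + 1) ^ K : ℕ) : ℝ)) (P.L - 1) K a (msq * P.mesh K ^ 2) (M2 P K₀)
                  (baseEmb (one_le_n P K) (M2 P K₀)) (gammaT P K K₀) (boxField K K₀ j σ A) *ᵥ Φ)) ⟨z, hz⟩)
      ≤ 2 * c₁ * supN Φ := by
    rw [hTr, hDer i, hGr, holder_gauge hg]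
    exact main
  -- the torus dictionary: `(L^Kε)·D^ε u ↔ derivA·pull u`, `pull u = (L^Kε)²·greenA Φ`, `U(Ã_j(Γ)) ↔ transport`
  have keyx := smul_ofLp_covDeriv_toT C hK hK₀ hK₀' j hκσ A u ⟨z, hz⟩ i hze
  have keyx' := smul_ofLp_covDeriv_toT C hK hK₀ hK₀' j hκσ A u ⟨z', hz'⟩ i hze'
  simp only at keyx keyx'
  rw [hxz, hμ, hu, Matrix.mulVec_smul] at keyx
  rw [hxz', hμ, hu, Matrix.mulVec_smul] at keyx'
  have hfs : ∀ (w : ↥(Box (dd P) (P.L - 1) K (M2 P K₀)) × Fin N → ℝ) (y : ↥(Box (dd P) (P.L - 1) K (M2 P K₀))) (r : ℝ),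
      fld (r • w) y = r • fld w y := fun w y r => rfl
  rw [hfs] at keyx keyx'
  have hhol := ofLp_hol C hK hK₀ hK₀' hN3 hh2 hS3 j hκσ A lB ⟨z, hz⟩ hxz hchB
    (covDeriv C (cubeVec K K₀ j A) u ⟨x', μ⟩)
  rw [hlB] at hhol
  set Wt := transport (fieldLink (flowC C) (ec / (((P.L - 1 + 1) ^ K : ℕ) : ℝ)) (boxField K K₀ j σ A))
      (⟨z, hz⟩ : ↥(Box (dd P) (P.L - 1) K (M2 P K₀))) lB with hWt
  set Dg := derivA (dd P) (flowC C) (ec / (((P.L - 1 + 1) ^ K : ℕ) : ℝ)) (P.L - 1) K (M2 P K₀) (boxField K K₀ j σ A) i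
      *ᵥ (greenA (dd P) (flowC C) (ec / (((P.L - 1 + 1) ^ K : ℕ) : ℝ)) (P.L - 1) K a (msq * P.mesh K ^ 2) (M2 P K₀)
          (baseEmb (one_le_n P K) (M2 P K₀)) (gammaT P K K₀) (boxField K K₀ j σ A) *ᵥ Φ) with hDg
  -- `(L^Kε)·(U(Γ)D u(x′) − D u(x))` on coordinates `= (L^Kε)²·(Wt·fld Dg z′ − fld Dg z)`
  have hcoord : WithLp.ofLp (P.mesh K • (hol C (cubeVec K K₀ j A) x l (covDeriv C (cubeVec K K₀ j A) u ⟨x', μ⟩)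
        - covDeriv C (cubeVec K K₀ j A) u ⟨x, μ⟩))
      = P.mesh K ^ 2 • (Wt *ᵥ fld Dg ⟨z', hz'⟩ - fld Dg ⟨z, hz⟩) := by
    rw [WithLp.ofLp_smul, WithLp.ofLp_sub, hhol, smul_sub, ← Matrix.mulVec_smul, keyx', keyx, Matrix.mulVec_smul, ← smul_sub]
  have hnorm : P.mesh K * ‖hol C (cubeVec K K₀ j A) x l (covDeriv C (cubeVec K K₀ j A) u ⟨x', μ⟩) - covDeriv C (cubeVec K K₀ j A) u ⟨x, μ⟩‖
      = P.mesh K ^ 2 * siteNorm (Wt *ᵥ fld Dg ⟨z', hz'⟩ - fld Dg ⟨z, hz⟩) := by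
    have h1 : P.mesh K * ‖hol C (cubeVec K K₀ j A) x l (covDeriv C (cubeVec K K₀ j A) u ⟨x', μ⟩) - covDeriv C (cubeVec K K₀ j A) u ⟨x, μ⟩‖
        = ‖P.mesh K • (hol C (cubeVec K K₀ j A) x l (covDeriv C (cubeVec K K₀ j A) u ⟨x', μ⟩) - covDeriv C (cubeVec K K₀ j A) u ⟨x, μ⟩)‖ := by
      rw [norm_smul, Real.norm_eq_abs, abs_of_pos hmeshK]
    rw [h1, ← siteNorm_ofLp, hcoord, siteNorm_smul, abs_of_pos (by positivity)]
  -- sizes: `supN Φ ≤ ‖ψ‖`, `|z′ − z|_∞ ≤ |Γ| ≤ d|x − x′|`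
  have hKM : ∀ ν, K₀ ∣ M2 P K₀ ν := fun ν => ⟨2, by unfold M2; ring⟩
  have hHS := hsize_hBox (d := dd P) hn hK₀' (le_trans (by norm_num) hnK) hKM (fun _ : Fin (dd P + 1) => (1 : ℤ))
  have hΦψ : supN Φ ≤ ‖ψ‖ := (supN_mulH_le hHS.abs_le _).trans (supN_pull_le j ψ)
  have hsNl : supNorm (z' - z) ≤ (P.d : ℝ) * HiggsLattice.Site.tdist x x' := by
    have h1 := supNorm_pathEnd_sub_le lB ⟨z, hz⟩ hNN
    rw [hlendB] at h1
    simp only at h1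
    rw [hlenB'] at h1
    exact h1.trans hlen
  -- `siteNorm(…) ≤ 2c₁ (|z′−z|_∞/n)^α supN Φ`
  have hratio : 0 < (((P.L - 1 + 1) ^ K : ℕ) : ℝ) / supNorm (z' - z) := div_pos hnr hsN0
  have hpow : 0 < ((((P.L - 1 + 1) ^ K : ℕ) : ℝ) / supNorm (z' - z)) ^ α := Real.rpow_pos_of_pos hratio α
  have hsite : siteNorm (Wt *ᵥ fld Dg ⟨z', hz'⟩ - fld Dg ⟨z, hz⟩)
      ≤ (supNorm (z' - z) / (((P.L - 1 + 1) ^ K : ℕ) : ℝ)) ^ α * (2 * c₁ * ‖ψ‖) := by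
    rw [← le_div_iff₀' hpow] at boxH
    have hinv : ((supNorm (z' - z) / (((P.L - 1 + 1) ^ K : ℕ) : ℝ)) ^ α)
        = (((((P.L - 1 + 1) ^ K : ℕ) : ℝ) / supNorm (z' - z)) ^ α)⁻¹ := by
      rw [← Real.inv_rpow hratio.le, inv_div]
    rw [hinv, ← div_eq_inv_mul]
    refine boxH.trans (div_le_div_of_nonneg_right ?_ hpow.le)
    exact mul_le_mul_of_nonneg_left hΦψ (by positivity)
  -- `(|z′−z|_∞/n)^α ≤ d·(|x−x′|/n)^α`
  have hd1' : (1 : ℝ) ≤ P.d := by exact_mod_cast P.hd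
  have htd0 : 0 ≤ (HiggsLattice.Site.tdist x x' : ℝ) := Nat.cast_nonneg _
  have hfac : (supNorm (z' - z) / (((P.L - 1 + 1) ^ K : ℕ) : ℝ)) ^ α
      ≤ (P.d : ℝ) * ((HiggsLattice.Site.tdist x x' : ℝ) / (P.L : ℝ) ^ K) ^ α := by
    rw [hnR]
    have hLK : (0 : ℝ) < (P.L : ℝ) ^ K := by rw [← hnR]; exact hnr
    calc (supNorm (z' - z) / (P.L : ℝ) ^ K) ^ α
        ≤ ((P.d : ℝ) * ((HiggsLattice.Site.tdist x x' : ℝ) / (P.L : ℝ) ^ K)) ^ α := by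
          refine Real.rpow_le_rpow (div_nonneg (supNorm_nonneg _) hLK.le) ?_ hα0
          rw [← mul_div_assoc]
          exact div_le_div_of_nonneg_right hsNl hLK.le
      _ = (P.d : ℝ) ^ α * ((HiggsLattice.Site.tdist x x' : ℝ) / (P.L : ℝ) ^ K) ^ α :=
          Real.mul_rpow (by positivity) (by positivity)
      _ ≤ (P.d : ℝ) * ((HiggsLattice.Site.tdist x x' : ℝ) / (P.L : ℝ) ^ K) ^ α := by
          refine mul_le_mul_of_nonneg_right ?_ (Real.rpow_nonneg (by positivity) _)
          calc (P.d : ℝ) ^ α ≤ (P.d : ℝ) ^ (1 : ℝ) := Real.rpow_le_rpow_of_exponent_le hd1' hα1.le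
            _ = P.d := Real.rpow_one _
  -- assembly
  have hfin : P.mesh K * ‖hol C (cubeVec K K₀ j A) x l (covDeriv C (cubeVec K K₀ j A) u ⟨x', μ⟩) - covDeriv C (cubeVec K K₀ j A) u ⟨x, μ⟩‖
      ≤ P.mesh K * (CH * ((HiggsLattice.Site.tdist x x' : ℝ) / (P.L : ℝ) ^ K) ^ α * P.mesh K * ‖ψ‖) := by
    rw [hnorm]
    calc P.mesh K ^ 2 * siteNorm (Wt *ᵥ fld Dg ⟨z', hz'⟩ - fld Dg ⟨z, hz⟩)
        ≤ P.mesh K ^ 2 * ((supNorm (z' - z) / (((P.L - 1 + 1) ^ K : ℕ) : ℝ)) ^ α * (2 * c₁ * ‖ψ‖)) :=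
          mul_le_mul_of_nonneg_left hsite (by positivity)
      _ ≤ P.mesh K ^ 2 * ((P.d : ℝ) * ((HiggsLattice.Site.tdist x x' : ℝ) / (P.L : ℝ) ^ K) ^ α * (2 * c₁ * ‖ψ‖)) :=
          mul_le_mul_of_nonneg_left (mul_le_mul_of_nonneg_right hfac (by positivity)) (by positivity)
      _ = P.mesh K * (CH * ((HiggsLattice.Site.tdist x x' : ℝ) / (P.L : ℝ) ^ K) ^ α * P.mesh K * ‖ψ‖) := by
          rw [hCH_def, ← hd1]; ring
  exact le_of_mul_le_mul_left hfin hmeshK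

end Inputs

end Literature.MathematicalPhysics.QuantumFieldTheory.Balaban1983to89.B1TorusCubeHolderInput
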